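import Literature.NumberTheory.Automorphic.ArchCompactPlaceOrbitalSmooth      -- ★ p841313 (A-p18 (g24)): `compactSpace_archLocal_of_posDef`; brings `archLocal`, `circleDiagonal`, ★ `ArchLocalTorusOrbitalDeriv`
import Literature.Analysis.Calculus.IteratedFDerivParametricIntegral           -- ★ Hörmander Thm. 1.1.9 `contDiff_integral_of_dominated_iteratedFDeriv`, `continuous_iteratedFDeriv_comp_affine(_param)`
import Mathlib.Analysis.Calculus.BumpFunction.FiniteDimension
import Mathlib.Analysis.Calculus.IteratedDeriv.Lemmas
import HarnessLib

/-!
# Compact-place line derivatives (the ANALYTIC ENGINE of the `U(3)` half of the central limit formula): at a DEFINITE place the torus orbital function is `C^∞` in all angles,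
# and along every line through the centre `(d∕ds)³|₀ ['Δ · Φ(·, f)] = 'Δ‴(0) · ν(U(3)) · f(ζ)` (Rogawski 1990 §8.4 pp. 126–127; §14.5 p. 239)

Topic `NumberTheory/Rogawski1990`; namespaces `Literature.Analysis.Calculus` (§1, §3 generic), `Literature.NumberTheory.Automorphic.UnitaryGroup` (§2), `Literature.NumberTheory.Rogawski1990` (§4–§5).
THEOREMS ONLY (no `def`, no instance, no notation, no axiom, no named fact, no `sorry`).  Cell `pub/hodgecm-mathlib`, ENGINE T1 (crux H413 = `stmt-HodgeConjecture-24833`);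
floor-1½ preparation, count-neutral, under row (S-d) ∕ `stub_SdCanonical` of the «SdArch» pay-down line: brick **(L_{U(3)})-ENGINE «COMPACT-PLACE LINE DERIVATIVES»** = the analytic
engine of R4 ROAD A's cheap half (F0P3a-p03 (g11) census `CENSUS-R4-refresh` 934e0f7c §2; LEAD F0P3a-plan (g9) WORDS T8-123 ∕ T8-126 (1), 2026-09-01; author F0P3a-p05 (g12)).  The (Ω)
FUNCTIONAL STATEMENT with its constant (print's `ω[ρ·'Δ·Φ]` polarised into line cubes) is F0P3a-p03 (g11)'s `Rogawski1990/ArchCompactPlaceCentralLimitFormula.lean`, importing this file.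

THE MATHEMATICS.  At a complex place `w₀` where `diag α` is DEFINITE, `G = U(σ_{w₀} diag α)(ℂ) ≅ U(N)` is COMPACT (★ `compactSpace_archLocal_of_posDef`).  For a finite measure `μ` on `G` (its
Haar measure) and a smooth `Θ′ : M_N(ℂ) → E` the torus orbital function of ALL the angles, `Φ(θ) = ∫_G Θ′(↑↑(k · diag(ζ_i e^{iθ_i}) · k⁻¹)) dμ(k)`, `θ ∈ ℝ^N`, is `C^∞` on all of `ℝ^N` (§2; no
support hypothesis, no wall): the integrand is `Ψ((↑k, ↑k⁻¹), θ)` for the jointly smooth `Ψ((A, B), θ) = Θ′(A · diag(ζ e^{iθ}) · B)`, and §1 proves in general that `X ↦ ∫_Y Ψ(y(t), X) dμ(t)`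
is `C^∞` for `Y` compact, `μ` finite, `y` continuous, `Ψ` smooth (Hörmander's theorem ★ after a smooth cutoff in `X`, the parameter entering through the translation `(y t, 0)` of the affine
machinery ★ `continuous_iteratedFDeriv_comp_affine`).  At a CENTRAL torus point (all `ζ_i e^{iθ_i}` equal) conjugation is trivial and `Φ(θ) = μ(G) · Θ′(↑↑diag)`.  For `N = 3`, print's
`'Δ(θ) = ∏_{i<j}(1 − e^{i(θ_j − θ_i)})` vanishes to order `3` at the centre; along the line `θ = s·v`, `δ_v(s) = 'Δ(s v)` has `δ_v(0) = δ_v′(0) = δ_v″(0) = 0` and `δ_v‴(0) = 6i(v₁−v₀)(v₂−v₀)(v₂−v₁)`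
(§4, Leibniz §3), whence THE HEAD (§5): `(d∕ds)³|₀ [δ_v(s) · Φ(s v)] = 6i(v₁−v₀)(v₂−v₀)(v₂−v₁) · μ(G) · Θ′(↑↑(ζ₀·1))` — print's «`ω('Δ·Φ_{U(3)})(ζ) = ω('Δ)(ζ) · Φ(ζ, f)`, `Φ(ζ, f) = ν(U(3))·f(ζ)`»
[§8.4 p. 126–127] read along lines through the centre: every constant-coefficient cubic `P(∂)` (print's `ω = ∏_{i<j}(∂_i − ∂_j)`) is a combination of line cubes `(v·∂)³`
(`24abc = (a+b+c)³ − (a+b−c)³ − (a−b+c)³ + (a−b−c)³`), so this is the `U(3)` value of any such functional, with EXPLICIT constant (on `ω`: `−12i · μ(G)`).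
* §1 `contDiff_integral_comp_of_contDiff` (generic: compact parameter space, finite measure, jointly smooth integrand).
* §2 **`contDiff_integral_comp_conj_circleDiagonal_angles_of_posDef`** (`N`-general, all angles, all orders; upgrades ★ A-p18 `contDiff_one_…_of_posDef` and ★ p841730) and
  `integral_comp_conj_circleDiagonal_eq_smul_of_forall_eq` (central value).
* §3 one-variable Leibniz at order `3` (Mathlib `iteratedDeriv_mul`): `iteratedDeriv_three_mul_eq_of_jet_eq_zero`, `iteratedDeriv_mul_mul_of_eq_zero` (+ the vanishing of orders `0,1,2`).
* §4 the Weyl denominator of `U(3)` along a line: `weylDenominatorLine_jet` (orders `0,1,2` vanish, order `3` `= 6i∏`).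
* §5 HEAD **`iteratedDeriv_three_weylDenominator_mul_orbital_line_of_posDef`**; `contDiff_orbital_line_of_posDef` (the line restriction is smooth, for the designer's `Λ_w`).
HONEST LABEL: HC_CM is proved only modulo the printed citations until rung 0 closes; no functional `Λ_w`∕`ω` and no constant `c(U(3), ν)` is fixed here (p03's (Ω) file does that over these
heads, with print's extra factor `ρ(γ) = e^{i(θ₁−θ₃)}` absorbed by §3 at `g := ρ·Φ`); the `U(2,1)` half (HC's limit formula at a NONCOMPACT real form) is the floor-2 core and NOT here.

## References
* [Rogawski1990] J. D. Rogawski, *Automorphic Representations of Unitary Groups in Three Variables*, Ann. of Math. Stud. 123 (1990), §8.4 pp. 125–128 (`ω`, `'Δ`, `c_G`, the `U(3)` side and the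
  factor `3 = |Ω_{U(3)}(T)|∕|Ω_{U(2,1)}(T)|`), §14.5 p. 239.
* [HormanderALPDO1] L. Hörmander, *The Analysis of Linear Partial Differential Operators I*, 2nd ed. (1990), Thm. 1.1.9 (smooth dependence of integrals on parameters).
* [Folland1995] G. B. Folland, *A Course in Abstract Harmonic Analysis* (1995), §2.6.
* [Varadarajan1989] V. S. Varadarajan, *An Introduction to Harmonic Analysis on Semisimple Lie Groups* (1989), §6.4 (limit formulas; rank one).
-/

set_option autoImplicit false

noncomputable section

open MeasureTheory Measure Filter Topology Set Function Metric NumberField NumberField.InfinitePlace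
open scoped ContDiff

/-! ## §1 Smooth dependence on a finite-dimensional parameter for integrals over a compact space -/

namespace Literature.Analysis.Calculus

section Generic

variable {Y : Type*} [TopologicalSpace Y] [MeasurableSpace Y] [OpensMeasurableSpace Y] [CompactSpace Y]
  {P : Type*} [NormedAddCommGroup P] [NormedSpace ℝ P]
  {V : Type*} [NormedAddCommGroup V] [NormedSpace ℝ V] [FiniteDimensional ℝ V]
  {F : Type*} [NormedAddCommGroup F] [NormedSpace ℝ F] [CompleteSpace F]

/-- **SMOOTH DEPENDENCE ON PARAMETERS OVER A COMPACT SPACE**: for `Y` compact, `μ` a finite measure on `Y`, `Ψ : P × V → F` smooth (`V` finite-dimensional) and `y : Y → P` continuous,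
`X ↦ ∫_Y Ψ(y t, X) dμ(t)` is `C^∞` on `V`.  Proof: locally, after a smooth cutoff `χ = 1` near `X₀` (so that all `X`-derivatives are bounded on `Y × tsupport χ`), Hörmander's theorem ★
`contDiff_integral_of_dominated_iteratedFDeriv` with the affine presentation `(χ·Ψ)(inr X + (y t, 0))` (★ `continuous_iteratedFDeriv_comp_affine`). [cite: HormanderALPDO1, Thm. 1.1.9] [cite: Folland1995, §2.6] -/
theorem contDiff_integral_comp_of_contDiff (μ : Measure Y) [IsFiniteMeasure μ] (Ψ : P × V → F) (hΨ : ContDiff ℝ ∞ Ψ) (y : Y → P) (hy : Continuous y) :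
    ContDiff ℝ ∞ fun X : V => ∫ t, Ψ (y t, X) ∂μ := by
  refine contDiff_iff_contDiffAt.2 fun X₀ => ?_
  -- a smooth compactly supported cutoff `χ = 1` near `X₀` (Mathlib bump on the Euclidean model of `V`)
  set e : V ≃L[ℝ] EuclideanSpace ℝ (Fin (Module.finrank ℝ V)) := toEuclidean with he
  let b : ContDiffBump (e X₀) := ⟨1, 2, one_pos, one_lt_two⟩
  set χ : V → ℝ := fun X => b (e X) with hχ
  have hχd : ContDiff ℝ ∞ χ := b.contDiff.comp e.contDiff
  have hχc : HasCompactSupport χ := b.hasCompactSupport.comp_homeomorph e.toHomeomorph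
  have hχ1 : ∀ᶠ X in 𝓝 X₀, χ X = 1 := by
    have hev : ∀ᶠ X in 𝓝 X₀, e X ∈ Metric.closedBall (e X₀) 1 :=
      e.continuous.continuousAt.eventually_mem (Metric.closedBall_mem_nhds _ one_pos)
    exact hev.mono fun X hX => b.one_of_mem_closedBall hX
  -- the cut integrand in the affine presentation `Ψχ (L X + c t)`, `L = inr`, `c t = (y t, 0)`
  set Ψχ : P × V → F := fun q => χ q.2 • Ψ q with hΨχ
  have hΨχd : ContDiff ℝ ∞ Ψχ := (hχd.comp contDiff_snd).smul hΨ
  set L : V →L[ℝ] P × V := ContinuousLinearMap.inr ℝ P V with hL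
  set c : Y → P × V := fun t => (y t, 0) with hc
  have hcc : Continuous c := hy.prodMk continuous_const
  have hLc : ∀ t X, L X + c t = (y t, X) := fun t X => by
    rw [hL, hc, ContinuousLinearMap.inr_apply, Prod.mk_add_mk, zero_add, add_zero]
  set H : Y → V → F := fun t X => Ψχ (L X + c t) with hH
  -- Hörmander's hypotheses
  have h1 : ∀ t, ContDiff ℝ ∞ (H t) := fun t => hΨχd.comp ((L.contDiff).add contDiff_const)
  have h2 : ∀ (n : ℕ) (X : V), AEStronglyMeasurable (fun t => iteratedFDeriv ℝ n (H t) X) μ := fun n X =>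
    ((continuous_iteratedFDeriv_comp_affine_param hΨχd L hcc n X).stronglyMeasurable_of_hasCompactSupport
      (IsCompact.of_isClosed_subset isCompact_univ (isClosed_tsupport _) (Set.subset_univ _))).aestronglyMeasurable
  have h3 : ∀ n : ℕ, ∃ g : Y → ℝ, Integrable g μ ∧ ∀ t X, ‖iteratedFDeriv ℝ n (H t) X‖ ≤ g t := by
    intro n
    have hjc : Continuous fun q : Y × V => iteratedFDeriv ℝ n (fun X => Ψχ (L X + c q.1)) q.2 := continuous_iteratedFDeriv_comp_affine hΨχd L hcc n
    obtain ⟨B, hB⟩ := (isCompact_univ.prod hχc.isCompact).exists_bound_of_continuousOn (f := fun q : Y × V => iteratedFDeriv ℝ n (fun X => Ψχ (L X + c q.1)) q.2)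
      hjc.continuousOn
    refine ⟨fun _ => max B 0, integrable_const _, fun t X => ?_⟩
    by_cases hX : X ∈ tsupport χ
    · exact (hB (t, X) ⟨Set.mem_univ _, hX⟩).trans (le_max_left _ _)
    · have hsupp : tsupport (H t) ⊆ tsupport χ := by
        have hHt : H t = fun X => χ X • Ψ (y t, X) := by
          funext X; rw [hH]; simp only [hΨχ, hLc]
        rw [hHt]
        exact tsupport_smul_subset_left _ _
      have h0 : iteratedFDeriv ℝ n (H t) X = 0 := by
        by_contra hne
        exact hX (hsupp (support_iteratedFDeriv_subset n (Function.mem_support.2 hne)))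
      rw [h0, norm_zero]
      exact le_max_right _ _
  have hsmooth : ContDiff ℝ ∞ fun X => ∫ t, H t X ∂μ := contDiff_integral_of_dominated_iteratedFDeriv h1 h2 h3
  -- near `X₀` the cut integral is the integral
  refine (hsmooth.contDiffAt (x := X₀)).congr_of_eventuallyEq (hχ1.mono fun X hX1 => ?_)
  refine integral_congr_ae (Eventually.of_forall fun t => ?_)
  simp only [hH, hΨχ, hLc, hX1, one_smul]

end Generic

/-! ## §3 One-variable Leibniz at order three with a vanishing 2-jet -/

section Leibniz

variable {f g f₁ f₂ f₃ : ℝ → ℂ} {x : ℝ}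

/-- **`(f g)‴(x) = f‴(x) g(x)` when `f(x) = f′(x) = f″(x) = 0`** (Mathlib `iteratedDeriv_mul`: the other three Leibniz terms vanish). [cite: Rogawski1990, §8.4 p. 126] -/
theorem iteratedDeriv_three_mul_eq_of_jet_eq_zero (hf : ContDiffAt ℝ 3 f x) (hg : ContDiffAt ℝ 3 g x)
    (h0 : f x = 0) (h1 : deriv f x = 0) (h2 : iteratedDeriv 2 f x = 0) :
    iteratedDeriv 3 (f * g) x = iteratedDeriv 3 f x * g x := by
  rw [iteratedDeriv_mul hf hg]
  simp only [Finset.sum_range_succ, Finset.sum_range_zero, Nat.sub_zero, Nat.sub_self, show (3 : ℕ) - 1 = 2 from rfl, show (3 : ℕ) - 2 = 1 from rfl,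
    iteratedDeriv_zero, iteratedDeriv_one, h0, h1, h2, zero_mul, mul_zero, add_zero, zero_add, Nat.choose_self, Nat.cast_one, one_mul]

/-- **THE JET OF A TRIPLE PRODUCT OF FUNCTIONS VANISHING AT `x`**: for `f₁, f₂, f₃` of class `C³` at `x` with `fₚ(x) = 0`: `(f₁f₂f₃)(x) = (f₁f₂f₃)′(x) = (f₁f₂f₃)″(x) = 0` and
`(f₁f₂f₃)‴(x) = 6 f₁′(x) f₂′(x) f₃′(x)` (Leibniz twice). [cite: Rogawski1990, §8.4 p. 126] -/
theorem iteratedDeriv_mul_mul_of_eq_zero (hf₁ : ContDiffAt ℝ 3 f₁ x) (hf₂ : ContDiffAt ℝ 3 f₂ x) (hf₃ : ContDiffAt ℝ 3 f₃ x)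
    (h₁ : f₁ x = 0) (h₂ : f₂ x = 0) (h₃ : f₃ x = 0) :
    (f₁ * f₂ * f₃) x = 0 ∧ deriv (f₁ * f₂ * f₃) x = 0 ∧ iteratedDeriv 2 (f₁ * f₂ * f₃) x = 0 ∧
      iteratedDeriv 3 (f₁ * f₂ * f₃) x = 6 * deriv f₁ x * deriv f₂ x * deriv f₃ x := by
  have h3 : (3 : WithTop ℕ∞) = ((3 : ℕ) : WithTop ℕ∞) := rfl
  have hd₁ : DifferentiableAt ℝ f₁ x := hf₁.differentiableAt (by norm_num)
  have hd₂ : DifferentiableAt ℝ f₂ x := hf₂.differentiableAt (by norm_num)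
  have hd₃ : DifferentiableAt ℝ f₃ x := hf₃.differentiableAt (by norm_num)
  have hF : ContDiffAt ℝ 3 (f₁ * f₂) x := hf₁.mul hf₂
  have hdF : DifferentiableAt ℝ (f₁ * f₂) x := hF.differentiableAt (by norm_num)
  -- the jet of `F = f₁ f₂`
  have hF0 : (f₁ * f₂) x = 0 := by rw [Pi.mul_apply, h₁, zero_mul]
  have hF1 : deriv (f₁ * f₂) x = 0 := by
    rw [deriv_mul hd₁ hd₂, h₁, h₂, mul_zero, zero_mul, add_zero]
  have hF2 : iteratedDeriv 2 (f₁ * f₂) x = 2 * deriv f₁ x * deriv f₂ x := by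
    rw [iteratedDeriv_mul (hf₁.of_le (by norm_num)) (hf₂.of_le (by norm_num))]
    simp only [Finset.sum_range_succ, Finset.sum_range_zero, Nat.sub_zero, Nat.sub_self, show (2 : ℕ) - 1 = 1 from rfl, iteratedDeriv_zero, iteratedDeriv_one,
      h₁, h₂, zero_mul, mul_zero, add_zero, zero_add, Nat.choose_one_right, Nat.cast_ofNat]
  refine ⟨?_, ?_, ?_, ?_⟩
  · rw [Pi.mul_apply, hF0, zero_mul]
  · rw [deriv_mul hdF hd₃, hF0, hF1, zero_mul, zero_mul, add_zero]
  · rw [iteratedDeriv_mul (hF.of_le (by norm_num)) (hf₃.of_le (by norm_num))]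
    simp only [Finset.sum_range_succ, Finset.sum_range_zero, Nat.sub_zero, Nat.sub_self, show (2 : ℕ) - 1 = 1 from rfl, iteratedDeriv_zero, iteratedDeriv_one,
      hF0, hF1, h₃, zero_mul, mul_zero, add_zero]
  · rw [iteratedDeriv_mul hF hf₃]
    simp only [Finset.sum_range_succ, Finset.sum_range_zero, Nat.sub_zero, Nat.sub_self, show (3 : ℕ) - 1 = 2 from rfl, show (3 : ℕ) - 2 = 1 from rfl,
      iteratedDeriv_zero, iteratedDeriv_one, hF0, hF1, hF2, h₃, zero_mul, mul_zero, add_zero, zero_add, show Nat.choose 3 2 = 3 from rfl, Nat.cast_ofNat]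
    ring

end Leibniz

end Literature.Analysis.Calculus

/-! ## §2 At a definite place the torus orbital function is smooth in ALL the angles -/

namespace Literature.NumberTheory.Automorphic.UnitaryGroup

open Literature.Analysis.Calculus
open scoped Matrix MatrixGroups ComplexOrder
open scoped Matrix.Norms.Operator

section Angles

variable (L : Type) [Field L] (N : ℕ) (α : Fin N → L) (w₀ : {w : InfinitePlace L // IsComplex w})
  {E : Type*} [NormedAddCommGroup E] [NormedSpace ℝ E] [CompleteSpace E]
  [MeasurableSpace (archLocal L N (Matrix.diagonal α) w₀)] [BorelSpace (archLocal L N (Matrix.diagonal α) w₀)]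

/-- **`θ ↦ diag(ζ_i e^{iθ_i})` is smooth, `ℝ^N → M_N(ℂ)`** (entrywise, through the linear map `diag`). [cite: Rogawski1990, §8.4 p. 126] -/
theorem contDiff_coe_circleDiagonal_angles (ζ : Fin N → Circle) :
    ContDiff ℝ ∞ fun θ : Fin N → ℝ => ((circleDiagonal N fun i => ζ i * Circle.exp (θ i) : GL (Fin N) ℂ) : Matrix (Fin N) (Fin N) ℂ) := by
  let D : (Fin N → ℂ) →L[ℝ] Matrix (Fin N) (Fin N) ℂ := LinearMap.toContinuousLinearMap (Matrix.diagonalLinearMap (Fin N) ℝ ℂ)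
  have hD : ∀ d : Fin N → ℂ, D d = Matrix.diagonal d := fun _ => rfl
  have hfun : (fun θ : Fin N → ℝ => ((circleDiagonal N fun i => ζ i * Circle.exp (θ i) : GL (Fin N) ℂ) : Matrix (Fin N) (Fin N) ℂ)) =
      fun θ => D fun i : Fin N => ((ζ i * Circle.exp (θ i) : Circle) : ℂ) := by
    funext θ
    rw [coe_circleDiagonal, hD]
  rw [hfun]
  refine D.contDiff.comp (contDiff_pi.2 fun i => ?_)
  have h : (fun θ : Fin N → ℝ => ((ζ i * Circle.exp (θ i) : Circle) : ℂ)) = fun θ => (ζ i : ℂ) * Complex.exp ((θ i : ℂ) * Complex.I) := by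
    funext θ; rw [Circle.coe_mul, Circle.coe_exp]
  rw [h]
  exact contDiff_const.mul (Complex.contDiff_exp.comp (((Complex.ofRealCLM.contDiff.comp (contDiff_apply ℝ ℝ i))).mul contDiff_const))

/-- **(L_{U(3)}) ANALYTIC INPUT, `N`-GENERAL — AT A DEFINITE PLACE THE TORUS ORBITAL FUNCTION IS `C^∞` IN ALL THE ANGLES**: `θ ↦ ∫_{G} Θ′(↑↑(k · diag(ζ_i e^{iθ_i}) · k⁻¹)) dμ(k)` is
`ContDiff ℝ ∞` on `ℝ^N` for `G = U(σ_{w₀} diag α)(ℂ)` compact (`hpos`), `μ` finite, `Θ′` smooth — no support hypothesis, no wall (§1 with `Ψ((A,B), θ) = Θ′(A · diag(ζe^{iθ}) · B)`,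
`y(k) = (↑k, ↑k⁻¹)`).  The all-orders ∕ all-angles upgrade of ★ `contDiff_one_integral_comp_conj_circleDiagonal_of_posDef`. [cite: Rogawski1990, §8.4 p. 126; §14.5 p. 238]
[cite: HormanderALPDO1, Thm. 1.1.9] -/
theorem contDiff_integral_comp_conj_circleDiagonal_angles_of_posDef
    (hpos : ((Matrix.diagonal α).map (w₀.1.embedding : L →+* ℂ)).PosDef ∨ (-((Matrix.diagonal α).map (w₀.1.embedding : L →+* ℂ))).PosDef)
    (μ : Measure (archLocal L N (Matrix.diagonal α) w₀)) [IsFiniteMeasure μ] (Θ' : Matrix (Fin N) (Fin N) ℂ → E) (hΘ' : ContDiff ℝ ∞ Θ') (ζ : Fin N → Circle) :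
    ContDiff ℝ ∞ fun θ : Fin N → ℝ => ∫ k : archLocal L N (Matrix.diagonal α) w₀,
      Θ' ((((k * ⟨circleDiagonal N fun i => ζ i * Circle.exp (θ i), circleDiagonal_mem_archLocal_diagonal L N α w₀ _⟩ * k⁻¹ :
        archLocal L N (Matrix.diagonal α) w₀) : GL (Fin N) ℂ) : Matrix (Fin N) (Fin N) ℂ)) ∂μ := by
  haveI : CompactSpace (archLocal L N (Matrix.diagonal α) w₀) := compactSpace_archLocal_of_posDef L N α w₀ hpos
  set Ψ : (Matrix (Fin N) (Fin N) ℂ × Matrix (Fin N) (Fin N) ℂ) × (Fin N → ℝ) → E :=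
    fun q => Θ' (q.1.1 * ((circleDiagonal N fun i => ζ i * Circle.exp (q.2 i) : GL (Fin N) ℂ) : Matrix (Fin N) (Fin N) ℂ) * q.1.2) with hΨ
  have hΨd : ContDiff ℝ ∞ Ψ :=
    hΘ'.comp (((contDiff_fst.comp contDiff_fst).mul ((contDiff_coe_circleDiagonal_angles N ζ).comp contDiff_snd)).mul (contDiff_snd.comp contDiff_fst))
  set y : archLocal L N (Matrix.diagonal α) w₀ → Matrix (Fin N) (Fin N) ℂ × Matrix (Fin N) (Fin N) ℂ :=
    fun k => (((k : GL (Fin N) ℂ) : Matrix (Fin N) (Fin N) ℂ), (((k⁻¹ : archLocal L N (Matrix.diagonal α) w₀) : GL (Fin N) ℂ) : Matrix (Fin N) (Fin N) ℂ)) with hy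
  have hyc : Continuous y :=
    (Units.continuous_val.comp continuous_subtype_val).prodMk ((Units.continuous_val.comp continuous_subtype_val).comp continuous_inv)
  have key := contDiff_integral_comp_of_contDiff μ Ψ hΨd y hyc
  have hfun : (fun θ : Fin N → ℝ => ∫ k : archLocal L N (Matrix.diagonal α) w₀,
      Θ' ((((k * ⟨circleDiagonal N fun i => ζ i * Circle.exp (θ i), circleDiagonal_mem_archLocal_diagonal L N α w₀ _⟩ * k⁻¹ :
        archLocal L N (Matrix.diagonal α) w₀) : GL (Fin N) ℂ) : Matrix (Fin N) (Fin N) ℂ)) ∂μ) = fun X => ∫ t, Ψ (y t, X) ∂μ := by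
    funext θ
    refine integral_congr_ae (Eventually.of_forall fun k => ?_)
    simp only [hΨ, hy, coe_conj_archLocal]
  rw [hfun]
  exact key

omit [BorelSpace (archLocal L N (Matrix.diagonal α) w₀)] in
/-- **THE VALUE AT A CENTRAL TORUS POINT**: if all coordinates `ζ_i e^{iθ_i}` coincide, the torus point is the scalar `ζ_0 e^{iθ_0} · 1`, conjugation fixes it, and
`∫_G Θ′(↑↑(k·t·k⁻¹)) dμ = μ(G) · Θ′(↑↑t)`. [cite: Rogawski1990, §8.4 p. 126] -/
theorem integral_comp_conj_circleDiagonal_eq_smul_of_forall_eq (μ : Measure (archLocal L N (Matrix.diagonal α) w₀)) (Θ' : Matrix (Fin N) (Fin N) ℂ → E)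
    (z : Fin N → Circle) (hz : ∀ i j, z i = z j) :
    ∫ k : archLocal L N (Matrix.diagonal α) w₀, Θ' ((((k * ⟨circleDiagonal N z, circleDiagonal_mem_archLocal_diagonal L N α w₀ _⟩ * k⁻¹ :
        archLocal L N (Matrix.diagonal α) w₀) : GL (Fin N) ℂ) : Matrix (Fin N) (Fin N) ℂ)) ∂μ =
      μ.real Set.univ • Θ' ((circleDiagonal N z : GL (Fin N) ℂ) : Matrix (Fin N) (Fin N) ℂ) := by
  have hconst : ∀ k : archLocal L N (Matrix.diagonal α) w₀, ((((k * ⟨circleDiagonal N z, circleDiagonal_mem_archLocal_diagonal L N α w₀ _⟩ * k⁻¹ :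
      archLocal L N (Matrix.diagonal α) w₀) : GL (Fin N) ℂ) : Matrix (Fin N) (Fin N) ℂ)) = ((circleDiagonal N z : GL (Fin N) ℂ) : Matrix (Fin N) (Fin N) ℂ) := by
    intro k
    rcases isEmpty_or_nonempty (Fin N) with hN | ⟨⟨i₀⟩⟩
    · exact Subsingleton.elim _ _
    have hdiag : ((circleDiagonal N z : GL (Fin N) ℂ) : Matrix (Fin N) (Fin N) ℂ) = ((z i₀ : Circle) : ℂ) • (1 : Matrix (Fin N) (Fin N) ℂ) := by
      rw [coe_circleDiagonal, Matrix.smul_one_eq_diagonal]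
      congr 1; funext i; rw [hz i i₀]
    rw [coe_conj_archLocal]
    change ((k : GL (Fin N) ℂ) : Matrix (Fin N) (Fin N) ℂ) * ((circleDiagonal N z : GL (Fin N) ℂ) : Matrix (Fin N) (Fin N) ℂ) *
      (((k⁻¹ : archLocal L N (Matrix.diagonal α) w₀) : GL (Fin N) ℂ) : Matrix (Fin N) (Fin N) ℂ) = _
    rw [hdiag, Matrix.mul_smul, Matrix.mul_one, Matrix.smul_mul, Subgroup.coe_inv, Units.mul_inv]
  simp_rw [hconst]
  exact integral_const _

end Angles

end Literature.NumberTheory.Automorphic.UnitaryGroup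

/-! ## §4 The Weyl denominator of `U(3)` along a line through the centre, and §5 the head -/

namespace Literature.NumberTheory.Rogawski1990

open Literature.Analysis.Calculus Literature.NumberTheory.Automorphic Literature.NumberTheory.Automorphic.UnitaryGroup
open scoped Matrix MatrixGroups ComplexOrder
open scoped Matrix.Norms.Operator

section Weyl

/-- The factor `s ↦ 1 − e^{i s d}` of the Weyl denominator along a line: smooth, vanishing at `0`, with derivative `−i d` there. [cite: Rogawski1990, §8.4 p. 126] -/
theorem contDiff_and_jet_one_sub_cexp_line (d : ℝ) :
    ContDiff ℝ ∞ (fun s : ℝ => (1 : ℂ) - Complex.exp (Complex.I * (((s * d : ℝ)) : ℂ))) ∧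
      (fun s : ℝ => (1 : ℂ) - Complex.exp (Complex.I * (((s * d : ℝ)) : ℂ))) 0 = 0 ∧
      deriv (fun s : ℝ => (1 : ℂ) - Complex.exp (Complex.I * (((s * d : ℝ)) : ℂ))) 0 = -(Complex.I * d) := by
  have hlin : ContDiff ℝ ∞ fun s : ℝ => Complex.I * (((s * d : ℝ)) : ℂ) := contDiff_const.mul (Complex.ofRealCLM.contDiff.comp (contDiff_id.mul contDiff_const))
  refine ⟨contDiff_const.sub (Complex.contDiff_exp.comp hlin), by simp, ?_⟩
  have hd : HasDerivAt (fun s : ℝ => Complex.I * (((s * d : ℝ)) : ℂ)) (Complex.I * d) 0 := by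
    have h1 : HasDerivAt (fun s : ℝ => (((s * d : ℝ)) : ℂ)) ((d : ℝ) : ℂ) 0 := by
      have h := ((hasDerivAt_id (0 : ℝ)).mul_const d).ofReal_comp
      simpa using h
    simpa using h1.const_mul Complex.I
  have he : HasDerivAt (fun s : ℝ => Complex.exp (Complex.I * (((s * d : ℝ)) : ℂ))) (Complex.exp (Complex.I * (((0 * d : ℝ)) : ℂ)) * (Complex.I * d)) 0 :=
    (Complex.hasDerivAt_exp _).comp (0 : ℝ) hd
  rw [(he.const_sub (1 : ℂ)).deriv]
  simp

/-- **THE JET OF THE WEYL DENOMINATOR OF `U(3)` ALONG THE LINE `θ = s·v` AT THE CENTRE**: `δ_v(s) = ∏_{i<j}(1 − e^{i s (v_j − v_i)})` has `δ_v(0) = δ_v′(0) = δ_v″(0) = 0` and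
`δ_v‴(0) = 6 i (v₁ − v₀)(v₂ − v₀)(v₂ − v₁)` (§3 with the three factors' derivatives `−i(v_j − v_i)`, `(−i)³ = i`). [cite: Rogawski1990, §8.4 p. 126] -/
theorem weylDenominatorLine_jet (v : Fin 3 → ℝ) :
    ((fun s : ℝ => (1 : ℂ) - Complex.exp (Complex.I * (((s * (v 1 - v 0) : ℝ)) : ℂ))) * (fun s : ℝ => (1 : ℂ) - Complex.exp (Complex.I * (((s * (v 2 - v 0) : ℝ)) : ℂ))) *
        (fun s : ℝ => (1 : ℂ) - Complex.exp (Complex.I * (((s * (v 2 - v 1) : ℝ)) : ℂ)))) 0 = 0 ∧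
    deriv ((fun s : ℝ => (1 : ℂ) - Complex.exp (Complex.I * (((s * (v 1 - v 0) : ℝ)) : ℂ))) * (fun s : ℝ => (1 : ℂ) - Complex.exp (Complex.I * (((s * (v 2 - v 0) : ℝ)) : ℂ))) *
        (fun s : ℝ => (1 : ℂ) - Complex.exp (Complex.I * (((s * (v 2 - v 1) : ℝ)) : ℂ)))) 0 = 0 ∧
    iteratedDeriv 2 ((fun s : ℝ => (1 : ℂ) - Complex.exp (Complex.I * (((s * (v 1 - v 0) : ℝ)) : ℂ))) * (fun s : ℝ => (1 : ℂ) - Complex.exp (Complex.I * (((s * (v 2 - v 0) : ℝ)) : ℂ))) *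
        (fun s : ℝ => (1 : ℂ) - Complex.exp (Complex.I * (((s * (v 2 - v 1) : ℝ)) : ℂ)))) 0 = 0 ∧
    iteratedDeriv 3 ((fun s : ℝ => (1 : ℂ) - Complex.exp (Complex.I * (((s * (v 1 - v 0) : ℝ)) : ℂ))) * (fun s : ℝ => (1 : ℂ) - Complex.exp (Complex.I * (((s * (v 2 - v 0) : ℝ)) : ℂ))) *
        (fun s : ℝ => (1 : ℂ) - Complex.exp (Complex.I * (((s * (v 2 - v 1) : ℝ)) : ℂ)))) 0 =
      6 * Complex.I * (v 1 - v 0) * (v 2 - v 0) * (v 2 - v 1) := by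
  have h3le : (3 : WithTop ℕ∞) ≤ ∞ := WithTop.coe_le_coe.2 le_top
  obtain ⟨hc₁, h0₁, hd₁⟩ := contDiff_and_jet_one_sub_cexp_line (v 1 - v 0)
  obtain ⟨hc₂, h0₂, hd₂⟩ := contDiff_and_jet_one_sub_cexp_line (v 2 - v 0)
  obtain ⟨hc₃, h0₃, hd₃⟩ := contDiff_and_jet_one_sub_cexp_line (v 2 - v 1)
  obtain ⟨j0, j1, j2, j3⟩ := iteratedDeriv_mul_mul_of_eq_zero (hc₁.of_le h3le).contDiffAt (hc₂.of_le h3le).contDiffAt (hc₃.of_le h3le).contDiffAt h0₁ h0₂ h0₃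
  refine ⟨j0, j1, j2, ?_⟩
  rw [j3, hd₁, hd₂, hd₃]
  have hI3 : Complex.I * Complex.I * Complex.I = -Complex.I := by rw [Complex.I_mul_I]; ring
  push_cast
  linear_combination (-(6 : ℂ) * ((v 1 : ℂ) - (v 0 : ℂ)) * ((v 2 : ℂ) - (v 0 : ℂ)) * ((v 2 : ℂ) - (v 1 : ℂ))) * hI3

end Weyl

/-! ## §5 The head: the compact-place central limit formula along lines -/

section Head

variable (L : Type) [Field L] (α : Fin 3 → L) (w₀ : {w : InfinitePlace L // IsComplex w})
  [MeasurableSpace (archLocal L 3 (Matrix.diagonal α) w₀)] [BorelSpace (archLocal L 3 (Matrix.diagonal α) w₀)]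

/-- **THE LINE RESTRICTION OF THE TORUS ORBITAL FUNCTION THROUGH THE CENTRE IS SMOOTH**: `s ↦ ∫_G Θ′(↑↑(k · diag(ζ₀ e^{i s v_i}) · k⁻¹)) dμ(k)` is `C^∞` on `ℝ` (§2 composed with
the line `s ↦ s·v`) — the regularity the designer's functional `Λ_w = Σ_m c_m (d∕ds)³|₀ (· ∘ ℓ_{v_m})` needs on the `U(3)` side. [cite: Rogawski1990, §8.4 p. 126–127] -/
theorem contDiff_orbital_line_of_posDef
    (hpos : ((Matrix.diagonal α).map (w₀.1.embedding : L →+* ℂ)).PosDef ∨ (-((Matrix.diagonal α).map (w₀.1.embedding : L →+* ℂ))).PosDef)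
    (μ : Measure (archLocal L 3 (Matrix.diagonal α) w₀)) [IsFiniteMeasure μ] (Θ' : Matrix (Fin 3) (Fin 3) ℂ → ℂ) (hΘ' : ContDiff ℝ ∞ Θ') (ζ₀ : Circle) (v : Fin 3 → ℝ) :
    ContDiff ℝ ∞ fun s : ℝ => ∫ k : archLocal L 3 (Matrix.diagonal α) w₀,
      Θ' ((((k * ⟨circleDiagonal 3 fun i => ζ₀ * Circle.exp (s * v i), circleDiagonal_mem_archLocal_diagonal L 3 α w₀ _⟩ * k⁻¹ :
        archLocal L 3 (Matrix.diagonal α) w₀) : GL (Fin 3) ℂ) : Matrix (Fin 3) (Fin 3) ℂ)) ∂μ := by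
  have hline : ContDiff ℝ ∞ fun s : ℝ => fun i : Fin 3 => s * v i := contDiff_pi.2 fun i => contDiff_id.mul contDiff_const
  exact (contDiff_integral_comp_conj_circleDiagonal_angles_of_posDef L 3 α w₀ hpos μ Θ' hΘ' (fun _ => ζ₀)).comp hline

/-- **(L_{U(3)}) THE COMPACT-PLACE CENTRAL LIMIT FORMULA, ALONG LINES**: at a DEFINITE place `w₀` (`G = U(σ_{w₀} diag α)(ℂ)` compact), for a finite measure `μ` on `G`, a smooth
`Θ′ : M₃(ℂ) → ℂ`, a central base `ζ₀·1` and a direction `v ∈ ℝ³`: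
`(d∕ds)³|₀ [ ∏_{i<j}(1 − e^{is(v_j−v_i)}) · ∫_G Θ′(↑↑(k · diag(ζ₀ e^{isv_i}) · k⁻¹)) dμ(k) ] = 6i(v₁−v₀)(v₂−v₀)(v₂−v₁) · μ(G) · Θ′(↑↑diag(ζ₀,ζ₀,ζ₀))` — print's
«`ω('Δ·Φ_{U(3)}(·,f))(ζ) = ω('Δ)(ζ)·ν(U(3))·f(ζ)`», the `U(3)` side of the central limit formula with MATCHED constants [§8.4 pp. 126–127], read on the line cubes `(v·∂)³`
of which every third-order constant-coefficient operator (in particular `ω = ∏_{i<j}(∂_i − ∂_j)`) is a finite combination. [cite: Rogawski1990, §8.4 pp. 126–127; §14.5 p. 239] -/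
theorem iteratedDeriv_three_weylDenominator_mul_orbital_line_of_posDef
    (hpos : ((Matrix.diagonal α).map (w₀.1.embedding : L →+* ℂ)).PosDef ∨ (-((Matrix.diagonal α).map (w₀.1.embedding : L →+* ℂ))).PosDef)
    (μ : Measure (archLocal L 3 (Matrix.diagonal α) w₀)) [IsFiniteMeasure μ] (Θ' : Matrix (Fin 3) (Fin 3) ℂ → ℂ) (hΘ' : ContDiff ℝ ∞ Θ') (ζ₀ : Circle) (v : Fin 3 → ℝ) :
    iteratedDeriv 3 (fun s : ℝ =>
      ((1 : ℂ) - Complex.exp (Complex.I * (((s * (v 1 - v 0) : ℝ)) : ℂ))) * ((1 : ℂ) - Complex.exp (Complex.I * (((s * (v 2 - v 0) : ℝ)) : ℂ))) *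
          ((1 : ℂ) - Complex.exp (Complex.I * (((s * (v 2 - v 1) : ℝ)) : ℂ))) *
        ∫ k : archLocal L 3 (Matrix.diagonal α) w₀,
          Θ' ((((k * ⟨circleDiagonal 3 fun i => ζ₀ * Circle.exp (s * v i), circleDiagonal_mem_archLocal_diagonal L 3 α w₀ _⟩ * k⁻¹ :
            archLocal L 3 (Matrix.diagonal α) w₀) : GL (Fin 3) ℂ) : Matrix (Fin 3) (Fin 3) ℂ)) ∂μ) 0 =
      6 * Complex.I * (v 1 - v 0) * (v 2 - v 0) * (v 2 - v 1) *
        (μ.real Set.univ • Θ' ((circleDiagonal 3 (fun _ : Fin 3 => ζ₀) : GL (Fin 3) ℂ) : Matrix (Fin 3) (Fin 3) ℂ)) := by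
  -- the two factors
  set δ : ℝ → ℂ := (fun s : ℝ => (1 : ℂ) - Complex.exp (Complex.I * (((s * (v 1 - v 0) : ℝ)) : ℂ))) * (fun s : ℝ => (1 : ℂ) - Complex.exp (Complex.I * (((s * (v 2 - v 0) : ℝ)) : ℂ))) *
    (fun s : ℝ => (1 : ℂ) - Complex.exp (Complex.I * (((s * (v 2 - v 1) : ℝ)) : ℂ))) with hδ
  set Φ : ℝ → ℂ := fun s : ℝ => ∫ k : archLocal L 3 (Matrix.diagonal α) w₀,
      Θ' ((((k * ⟨circleDiagonal 3 fun i => ζ₀ * Circle.exp (s * v i), circleDiagonal_mem_archLocal_diagonal L 3 α w₀ _⟩ * k⁻¹ :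
        archLocal L 3 (Matrix.diagonal α) w₀) : GL (Fin 3) ℂ) : Matrix (Fin 3) (Fin 3) ℂ)) ∂μ with hΦ
  have hfun : (fun s : ℝ =>
      ((1 : ℂ) - Complex.exp (Complex.I * (((s * (v 1 - v 0) : ℝ)) : ℂ))) * ((1 : ℂ) - Complex.exp (Complex.I * (((s * (v 2 - v 0) : ℝ)) : ℂ))) *
          ((1 : ℂ) - Complex.exp (Complex.I * (((s * (v 2 - v 1) : ℝ)) : ℂ))) *
        ∫ k : archLocal L 3 (Matrix.diagonal α) w₀,
          Θ' ((((k * ⟨circleDiagonal 3 fun i => ζ₀ * Circle.exp (s * v i), circleDiagonal_mem_archLocal_diagonal L 3 α w₀ _⟩ * k⁻¹ :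
            archLocal L 3 (Matrix.diagonal α) w₀) : GL (Fin 3) ℂ) : Matrix (Fin 3) (Fin 3) ℂ)) ∂μ) = δ * Φ := by
    funext s; simp only [hδ, hΦ, Pi.mul_apply]
  -- smoothness of the factors
  obtain ⟨hc₁, -, -⟩ := contDiff_and_jet_one_sub_cexp_line (v 1 - v 0)
  obtain ⟨hc₂, -, -⟩ := contDiff_and_jet_one_sub_cexp_line (v 2 - v 0)
  obtain ⟨hc₃, -, -⟩ := contDiff_and_jet_one_sub_cexp_line (v 2 - v 1)
  have hδd : ContDiff ℝ ∞ δ := by rw [hδ]; exact (hc₁.mul hc₂).mul hc₃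
  have hΦd : ContDiff ℝ ∞ Φ := by rw [hΦ]; exact contDiff_orbital_line_of_posDef L α w₀ hpos μ Θ' hΘ' ζ₀ v
  -- the jets
  obtain ⟨j0, j1, j2, j3⟩ := weylDenominatorLine_jet v
  have hΦ0 : Φ 0 = μ.real Set.univ • Θ' ((circleDiagonal 3 (fun _ : Fin 3 => ζ₀) : GL (Fin 3) ℂ) : Matrix (Fin 3) (Fin 3) ℂ) := by
    have hz : (fun i : Fin 3 => ζ₀ * Circle.exp ((0 : ℝ) * v i)) = fun _ => ζ₀ := by
      funext i; rw [zero_mul, Circle.exp_zero, mul_one]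
    rw [hΦ]
    simp only [hz]
    exact integral_comp_conj_circleDiagonal_eq_smul_of_forall_eq L 3 α w₀ μ Θ' (fun _ => ζ₀) (fun _ _ => rfl)
  have h3le : (3 : WithTop ℕ∞) ≤ ∞ := WithTop.coe_le_coe.2 le_top
  rw [hfun, iteratedDeriv_three_mul_eq_of_jet_eq_zero (hδd.of_le h3le).contDiffAt (hΦd.of_le h3le).contDiffAt j0 j1 j2, j3, hΦ0]

end Head

end Literature.NumberTheory.Rogawski1990

end
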